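import Summits.CriticalPhenomena.PercolationContinuityZ3.Theorems.PercNearOneGluingNoHeavyLowerTailSahiCTCRtForm
import Summits.CriticalPhenomena.PercolationContinuityZ3.Theorems.PercNearOneGluingNoHeavyLowerTailSahiCTCSmallWorldNA
import HarnessLib

/-!
# `NoHeavyLowerTail` (crux stmt-CriticalPhenomena-4575), P3 lane: THE SECTION-REPLACEMENT REDUCTION for `R_t ∈ ℕ[s]`

Support file (seat `prim-l12-p3`, gen 34; `--supports stmt-CriticalPhenomena-4575`).  Memo
`run/shared/lean/prim/prim-l12/FROM-prim-l12-p3-g34-LAMINAR-TRANSFER-AND-SECTION-REDUCTION.md` §4.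

For an up-set `𝒳 ⊆ 2^α` and a coordinate `i`, the two *section cylinders* are the up-sets
`𝒳^{i0} = {S : S.erase i ∈ 𝒳}` and `𝒳^{i1} = {S : insert i S ∈ 𝒳}` (neither reads `i`; `𝒳^{i0} ⊆ 𝒳 ⊆ 𝒳^{i1}`).
The SECTION-REPLACEMENT property (conjecture (M) of the memo, verified exhaustively for `|α| ≤ 4` and on ≈10⁶ sampled
instances for `|α| ≤ 6`) says: for every `t`, `i`, up-sets `𝒳, 𝒵` and profile `n`, the coefficient `[s^n] R_t(𝒳,𝒵)` is at least
the minimum of the four coefficients obtained by replacing `𝒳` by one of its section cylinders at `i`, or `𝒵` by one of its.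
THIS FILE proves the REDUCTION THEOREM: the section-replacement property implies `R_t(𝒳,𝒵) ∈ ℕ[s]` for ALL pairs of up-sets and
all `t` (`coeff_Rt_nonneg_of_section_replacement`), by induction on the number of coordinates read by both families, the base
case being independent supports (`…SahiCTCRtForm.coeff_Rt_nonneg_of_Nt` + `…SahiCTCSmallWorldNA.coeff_smallWorld_nonneg_of_determined`,
= `…SahiCTCRtIndependent.coeff_Rt_nonneg_of_determined`, re-derived inline here because that file has no farm build yet).
Nothing is asserted about the crux; the section-replacement property is a HYPOTHESIS here, not proved.
-/

noncomputable section

open scoped Classical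

namespace Summit.CriticalPhenomena.PercolationContinuityZ3.Theorems.SahiCTCForms

open Finset MvPolynomial SahiCTCGenFun

variable {α : Type*} [DecidableEq α] [Fintype α]

/-! ### Section cylinders are up-sets and read one coordinate fewer -/

/-- The `0`-section cylinder `{S : S.erase i ∈ 𝒳}` of an up-set is an up-set. [this work] -/
theorem isUpperSet_filter_erase_mem {𝒳 : Finset (Finset α)} (h𝒳 : IsUpperSet (𝒳 : Set (Finset α))) (i : α) :
    IsUpperSet ((univ.filter fun S : Finset α => S.erase i ∈ 𝒳 : Finset (Finset α)) : Set (Finset α)) := by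
  intro a b hab ha
  simp only [coe_filter, mem_univ, true_and, Set.mem_setOf_eq] at ha ⊢
  exact h𝒳 (erase_subset_erase i hab) ha

/-- The `1`-section cylinder `{S : insert i S ∈ 𝒳}` of an up-set is an up-set. [this work] -/
theorem isUpperSet_filter_insert_mem {𝒳 : Finset (Finset α)} (h𝒳 : IsUpperSet (𝒳 : Set (Finset α))) (i : α) :
    IsUpperSet ((univ.filter fun S : Finset α => insert i S ∈ 𝒳 : Finset (Finset α)) : Set (Finset α)) := by
  intro a b hab ha
  simp only [coe_filter, mem_univ, true_and, Set.mem_setOf_eq] at ha ⊢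
  exact h𝒳 (insert_subset_insert i hab) ha

omit [Fintype α] in
/-- `(S.erase i) ∩ I = ((S ∩ I.erase i).erase i) ∩ I`. [this work] -/
theorem erase_inter_eq_erase_inter_erase (S I : Finset α) (i : α) :
    S.erase i ∩ I = (S ∩ I.erase i).erase i ∩ I := by
  ext a
  simp only [mem_inter, mem_erase]
  tauto

omit [Fintype α] in
/-- `(insert i S) ∩ I = (insert i (S ∩ I.erase i)) ∩ I`. [this work] -/
theorem insert_inter_eq_insert_inter_erase (I : Finset α) (i : α) (S : Finset α) :
    insert i S ∩ I = insert i (S ∩ I.erase i) ∩ I := by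
  ext a
  simp only [mem_inter, mem_insert, mem_erase]
  constructor
  · rintro ⟨h | h, haI⟩
    · exact ⟨Or.inl h, haI⟩
    · by_cases hai : a = i
      · exact ⟨Or.inl hai, haI⟩
      · exact ⟨Or.inr ⟨h, hai, haI⟩, haI⟩
  · rintro ⟨h | ⟨h, -, -⟩, haI⟩
    · exact ⟨Or.inl h, haI⟩
    · exact ⟨Or.inr h, haI⟩

/-- If `𝒳` is determined by `I` (`S ∈ 𝒳 ↔ S ∩ I ∈ 𝒳`), its `0`-section cylinder at `i` is determined by `I.erase i`. [this work] -/
theorem filter_erase_mem_determined {𝒳 : Finset (Finset α)} {I : Finset α} (hX : ∀ S : Finset α, S ∈ 𝒳 ↔ S ∩ I ∈ 𝒳)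
    (i : α) (S : Finset α) :
    S ∈ (univ.filter fun T : Finset α => T.erase i ∈ 𝒳) ↔ S ∩ I.erase i ∈ (univ.filter fun T : Finset α => T.erase i ∈ 𝒳) := by
  simp only [mem_filter, mem_univ, true_and]
  rw [hX (S.erase i), hX ((S ∩ I.erase i).erase i), erase_inter_eq_erase_inter_erase]

/-- If `𝒳` is determined by `I`, its `1`-section cylinder at `i` is determined by `I.erase i`. [this work] -/
theorem filter_insert_mem_determined {𝒳 : Finset (Finset α)} {I : Finset α} (hX : ∀ S : Finset α, S ∈ 𝒳 ↔ S ∩ I ∈ 𝒳)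
    (i : α) (S : Finset α) :
    S ∈ (univ.filter fun T : Finset α => insert i T ∈ 𝒳) ↔ S ∩ I.erase i ∈ (univ.filter fun T : Finset α => insert i T ∈ 𝒳) := by
  simp only [mem_filter, mem_univ, true_and]
  rw [hX (insert i S), hX (insert i (S ∩ I.erase i)), insert_inter_eq_insert_inter_erase I i S]

omit [Fintype α] in
/-- `(I.erase i) ∩ J = (I ∩ J).erase i`. [this work] -/
theorem erase_inter_eq (I J : Finset α) (i : α) : I.erase i ∩ J = (I ∩ J).erase i := by
  ext a; simp only [mem_inter, mem_erase]; tauto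

omit [Fintype α] in
/-- `I ∩ (J.erase i) = (I ∩ J).erase i`. [this work] -/
theorem inter_erase_eq (I J : Finset α) (i : α) : I ∩ J.erase i = (I ∩ J).erase i := by
  ext a; simp only [mem_inter, mem_erase]; tauto

/-! ### The reduction theorem -/

/-- **REDUCTION THEOREM.**  If for every threshold `t`, coordinate `i`, up-sets `𝒳, 𝒵` and profile `n` the coefficient
`[s^n]R_t(𝒳,𝒵)` is at least the minimum of the four coefficients obtained by replacing `𝒳` (resp. `𝒵`) by one of its two section
cylinders at `i` (the section-replacement property, conjecture (M) of memo g34), then `R_t(𝒳,𝒵) ∈ ℕ[s]` for EVERY pair of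
up-sets and every `t`.  Proof: induction on the number of coordinates read by both families, down to independent supports
(independent supports: `coeff_Rt_nonneg_of_Nt` + `coeff_smallWorld_nonneg_of_determined`). [this work] -/
theorem coeff_Rt_nonneg_of_section_replacement
    (hM : ∀ (t : ℕ) (i : α) (𝒳 𝒵 : Finset (Finset α)), IsUpperSet (𝒳 : Set (Finset α)) → IsUpperSet (𝒵 : Set (Finset α)) →
      ∀ n : α →₀ ℕ,
        min (min ((Rt t (univ.filter fun S : Finset α => S.erase i ∈ 𝒳) 𝒵).coeff n)
                 ((Rt t (univ.filter fun S : Finset α => insert i S ∈ 𝒳) 𝒵).coeff n))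
            (min ((Rt t 𝒳 (univ.filter fun S : Finset α => S.erase i ∈ 𝒵)).coeff n)
                 ((Rt t 𝒳 (univ.filter fun S : Finset α => insert i S ∈ 𝒵)).coeff n))
          ≤ (Rt t 𝒳 𝒵).coeff n)
    {𝒳 𝒵 : Finset (Finset α)} (h𝒳 : IsUpperSet (𝒳 : Set (Finset α))) (h𝒵 : IsUpperSet (𝒵 : Set (Finset α)))
    (t : ℕ) (n : α →₀ ℕ) : 0 ≤ (Rt t 𝒳 𝒵).coeff n := by
  -- strengthened statement: for all pairs determined by `I`, `J` with `(I ∩ J).card ≤ k`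
  suffices key : ∀ (k : ℕ) (F G : Finset (Finset α)) (I J : Finset α), IsUpperSet (F : Set (Finset α)) →
      IsUpperSet (G : Set (Finset α)) → (∀ S : Finset α, S ∈ F ↔ S ∩ I ∈ F) → (∀ S : Finset α, S ∈ G ↔ S ∩ J ∈ G) →
      (I ∩ J).card ≤ k → 0 ≤ (Rt t F G).coeff n by
    exact key (univ ∩ univ : Finset α).card 𝒳 𝒵 univ univ h𝒳 h𝒵 (fun S => by rw [inter_univ]) (fun S => by rw [inter_univ]) le_rfl
  intro k
  induction k with
  | zero =>
    intro F G I J hF hG hI hJ hk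
    have hIJ : I ∩ J = ∅ := card_eq_zero.mp (Nat.le_zero.mp hk)
    have hZ : ∀ S : Finset α, S ∈ G ↔ S \ I ∈ G := fun S => by
      rw [hJ S, hJ (S \ I)]
      have : S \ I ∩ J = S ∩ J := by
        ext a
        simp only [mem_inter, mem_sdiff]
        constructor
        · rintro ⟨⟨h1, -⟩, h2⟩; exact ⟨h1, h2⟩
        · rintro ⟨h1, h2⟩
          refine ⟨⟨h1, fun haI => ?_⟩, h2⟩
          have : a ∈ I ∩ J := mem_inter.mpr ⟨haI, h2⟩
          rw [hIJ] at this
          exact absurd this (notMem_empty a)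
      rw [this]
    exact coeff_Rt_nonneg_of_Nt hF hG (fun m => by
      unfold Nt below bySize
      exact coeff_smallWorld_nonneg_of_determined hF hG hI hZ t m) n
  | succ k ih =>
    intro F G I J hF hG hI hJ hk
    by_cases hIJ : I ∩ J = ∅
    · exact ih F G I J hF hG hI hJ (by rw [hIJ, card_empty]; exact Nat.zero_le _)
    · obtain ⟨i, hi⟩ := nonempty_iff_ne_empty.mpr hIJ
      have hcard : ((I ∩ J).erase i).card ≤ k := by
        rw [card_erase_of_mem hi]; omega
      have h1 : 0 ≤ (Rt t (univ.filter fun S : Finset α => S.erase i ∈ F) G).coeff n :=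
        ih _ G (I.erase i) J (isUpperSet_filter_erase_mem hF i) hG (filter_erase_mem_determined hI i) hJ
          (by rw [erase_inter_eq]; exact hcard)
      have h2 : 0 ≤ (Rt t (univ.filter fun S : Finset α => insert i S ∈ F) G).coeff n :=
        ih _ G (I.erase i) J (isUpperSet_filter_insert_mem hF i) hG (filter_insert_mem_determined hI i) hJ
          (by rw [erase_inter_eq]; exact hcard)
      have h3 : 0 ≤ (Rt t F (univ.filter fun S : Finset α => S.erase i ∈ G)).coeff n :=
        ih F _ I (J.erase i) hF (isUpperSet_filter_erase_mem hG i) hI (filter_erase_mem_determined hJ i)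
          (by rw [inter_erase_eq]; exact hcard)
      have h4 : 0 ≤ (Rt t F (univ.filter fun S : Finset α => insert i S ∈ G)).coeff n :=
        ih F _ I (J.erase i) hF (isUpperSet_filter_insert_mem hG i) hI (filter_insert_mem_determined hJ i)
          (by rw [inter_erase_eq]; exact hcard)
      exact le_trans (le_min (le_min h1 h2) (le_min h3 h4)) (hM t i F G hF hG n)


/-! ### The reduction theorem with a coordinate CHOSEN per pair, threshold and profile

The `∀ i` form of the section-replacement property used above is REFUTED (gen 34, adversarial search): at `|α| = 6`,
`𝒳 = ↑{0,3,4} ∪ ↑{1,2,3,4} ∪ ↑{1,5}`, `𝒵 = ↑{0,1,2,3} ∪ ↑{0,2,3,4} ∪ ↑{5}`, profile `(1,2,1,1,1,2)`, `t = 4`, `i = 0` the coefficient is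
`25` while all four replacements give `26` (the other five shared coordinates satisfy the inequality).  What the induction really needs is only that
for every pair with a common coordinate SOME common coordinate works; this `∃` form has no known counterexample.  We record the reduction in that
form: the hypothesis now receives the determining sets `I ⊇ supp 𝒳`, `J ⊇ supp 𝒵` and returns a coordinate of `I ∩ J`. -/

/-- **REDUCTION THEOREM, `∃`-form.**  Suppose that for every threshold `t`, profile `n`, up-sets `𝒳, 𝒵` determined by coordinate sets `I, J`
(`S ∈ 𝒳 ↔ S ∩ I ∈ 𝒳`, `S ∈ 𝒵 ↔ S ∩ J ∈ 𝒵`) with `I ∩ J ≠ ∅` there is a coordinate `i ∈ I ∩ J` such that `[s^n]R_t(𝒳,𝒵)` is at least the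
minimum of the four coefficients obtained by replacing `𝒳` or `𝒵` by one of its section cylinders at `i`.  Then `R_t(𝒳,𝒵) ∈ ℕ[s]` for every
pair of up-sets and every `t`. [this work] -/
theorem coeff_Rt_nonneg_of_exists_section_replacement
    (hM : ∀ (t : ℕ) (n : α →₀ ℕ) (I J : Finset α) (𝒳 𝒵 : Finset (Finset α)), IsUpperSet (𝒳 : Set (Finset α)) →
      IsUpperSet (𝒵 : Set (Finset α)) → (∀ S : Finset α, S ∈ 𝒳 ↔ S ∩ I ∈ 𝒳) → (∀ S : Finset α, S ∈ 𝒵 ↔ S ∩ J ∈ 𝒵) →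
      (I ∩ J).Nonempty →
      ∃ i ∈ I ∩ J,
        min (min ((Rt t (univ.filter fun S : Finset α => S.erase i ∈ 𝒳) 𝒵).coeff n)
                 ((Rt t (univ.filter fun S : Finset α => insert i S ∈ 𝒳) 𝒵).coeff n))
            (min ((Rt t 𝒳 (univ.filter fun S : Finset α => S.erase i ∈ 𝒵)).coeff n)
                 ((Rt t 𝒳 (univ.filter fun S : Finset α => insert i S ∈ 𝒵)).coeff n))
          ≤ (Rt t 𝒳 𝒵).coeff n)
    {𝒳 𝒵 : Finset (Finset α)} (h𝒳 : IsUpperSet (𝒳 : Set (Finset α))) (h𝒵 : IsUpperSet (𝒵 : Set (Finset α)))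
    (t : ℕ) (n : α →₀ ℕ) : 0 ≤ (Rt t 𝒳 𝒵).coeff n := by
  suffices key : ∀ (k : ℕ) (F G : Finset (Finset α)) (I J : Finset α), IsUpperSet (F : Set (Finset α)) →
      IsUpperSet (G : Set (Finset α)) → (∀ S : Finset α, S ∈ F ↔ S ∩ I ∈ F) → (∀ S : Finset α, S ∈ G ↔ S ∩ J ∈ G) →
      (I ∩ J).card ≤ k → 0 ≤ (Rt t F G).coeff n by
    exact key (univ ∩ univ : Finset α).card 𝒳 𝒵 univ univ h𝒳 h𝒵 (fun S => by rw [inter_univ]) (fun S => by rw [inter_univ]) le_rfl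
  intro k
  induction k with
  | zero =>
    intro F G I J hF hG hI hJ hk
    have hIJ : I ∩ J = ∅ := card_eq_zero.mp (Nat.le_zero.mp hk)
    have hZ : ∀ S : Finset α, S ∈ G ↔ S \ I ∈ G := fun S => by
      rw [hJ S, hJ (S \ I)]
      have : S \ I ∩ J = S ∩ J := by
        ext a
        simp only [mem_inter, mem_sdiff]
        constructor
        · rintro ⟨⟨h1, -⟩, h2⟩; exact ⟨h1, h2⟩
        · rintro ⟨h1, h2⟩
          refine ⟨⟨h1, fun haI => ?_⟩, h2⟩
          have : a ∈ I ∩ J := mem_inter.mpr ⟨haI, h2⟩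
          rw [hIJ] at this
          exact absurd this (notMem_empty a)
      rw [this]
    exact coeff_Rt_nonneg_of_Nt hF hG (fun m => by
      unfold Nt below bySize
      exact coeff_smallWorld_nonneg_of_determined hF hG hI hZ t m) n
  | succ k ih =>
    intro F G I J hF hG hI hJ hk
    by_cases hIJ : I ∩ J = ∅
    · exact ih F G I J hF hG hI hJ (by rw [hIJ, card_empty]; exact Nat.zero_le _)
    · obtain ⟨i, hi, hmin⟩ := hM t n I J F G hF hG hI hJ (nonempty_iff_ne_empty.mpr hIJ)
      have hcard : ((I ∩ J).erase i).card ≤ k := by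
        rw [card_erase_of_mem hi]; omega
      have h1 : 0 ≤ (Rt t (univ.filter fun S : Finset α => S.erase i ∈ F) G).coeff n :=
        ih _ G (I.erase i) J (isUpperSet_filter_erase_mem hF i) hG (filter_erase_mem_determined hI i) hJ
          (by rw [erase_inter_eq]; exact hcard)
      have h2 : 0 ≤ (Rt t (univ.filter fun S : Finset α => insert i S ∈ F) G).coeff n :=
        ih _ G (I.erase i) J (isUpperSet_filter_insert_mem hF i) hG (filter_insert_mem_determined hI i) hJ
          (by rw [erase_inter_eq]; exact hcard)
      have h3 : 0 ≤ (Rt t F (univ.filter fun S : Finset α => S.erase i ∈ G)).coeff n :=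
        ih F _ I (J.erase i) hF (isUpperSet_filter_erase_mem hG i) hI (filter_erase_mem_determined hJ i)
          (by rw [inter_erase_eq]; exact hcard)
      have h4 : 0 ≤ (Rt t F (univ.filter fun S : Finset α => insert i S ∈ G)).coeff n :=
        ih F _ I (J.erase i) hF (isUpperSet_filter_insert_mem hG i) hI (filter_insert_mem_determined hJ i)
          (by rw [inter_erase_eq]; exact hcard)
      exact le_trans (le_min (le_min h1 h2) (le_min h3 h4)) hmin

end Summit.CriticalPhenomena.PercolationContinuityZ3.Theorems.SahiCTCForms
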